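import Summits.BirchSwinnertonDyer.Rank1Residual.X11b.BDPRouteLocalKernelBound
import Summits.BirchSwinnertonDyer.Rank1Residual.X11b.AnticyclotomicLocalTowerTorsion
import Summits.BirchSwinnertonDyer.Rank1Residual.X11b.AnticyclotomicLocalTorsionDescent
import Summits.BirchSwinnertonDyer.Rank1Residual.X11b.LocalTrivialityBridge
import HarnessLib

/-!
# Class X11b, route p2: Greenberg's Lemma 3.3 ABOVE `p` for the strict condition —
# `#ker (H¹(K_v, E[p^∞]) → H¹(K_{∞,w}, E[p^∞])) ≤ #E(K_v)[p^∞]`, NO hypothesis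
# (cell `b2b-bsdres`, sub-cell `multr1-p2`, gen 17)

HONEST FRAMING (verbatim, cell `b2b-bsdres`): the goal of the cell is to DELETE the
COMBINATION-SHAPED residual classes for ALL analytic-rank `≤ 1` curves over `ℚ` — "full BSD
formula for every rank `≤ 1` curve in class `C`" assembled STRICTLY from published theorems — so
that the rank-`≤ 1` remainder becomes exactly the CONSTRUCTION-SHAPED classes, which are TYPED
(missing-input Props), NOT attempted; this is not "finishing BSD". Research route `p2` for class
X11b; no claim beyond the stated class; nothing booked; X11b stays CONSTRUCTION-SHAPED. Theorems
only; no definition; no named fact; no `sorry`. Continues `BDPRouteLocalKernelCoinvariants` /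
`BDPRouteLocalKernelBound` (gen 13) and the sibling's `AnticyclotomicLocalTowerTorsion` /
`AnticyclotomicLocalTorsionDescent` (multr1-p1 gen 10).

## Content

Greenberg (LNM 1716, §3, proof of Lemma 3.3 and p. 90): at a place `v`, the local kernel
`ker r_v = H¹(K_{∞,w}/K_v, B_v)`, `B_v = E(K_{∞,w})[p^∞]`, is `B_v/(γ_v − 1)B_v`, and "the kernel of
`γ_v − 1` acting on `B_v` … is `E(K_v)[p^∞]`, finite". For the STRICT condition at a prime `𝔭`
above `p` (Castella's `H¹_ac(K_𝔭, ·) = 0`) the local kernel in the control diagram is this same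
group, and it is finite of order at most `#E(K_𝔭)[p^∞]` — with NO hypothesis on reduction type or on
the `ℤ_p`-extension — by an elementary count replacing divisibility arguments:

* `PrimaryCoker.natCard_quotient_range_le_natCard_ker` — for an endomorphism `φ` of an abelian
  group `B` in which every element is killed by a power of `p` and every `B[p^n]` is finite:
  if `ker φ` is finite then `B/φ(B)` is finite and `#B/φ(B) ≤ #ker φ` (each `B[p^n]` maps onto a
  subgroup of `B/φ(B)` of order `≤ #B[p^n]/#φ(B[p^n]) = #ker φ|_{B[p^n]} ≤ #ker φ`, and `B/φ(B)` is
  their union).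
* **`natCard_localKer_le_natCard_fixedPoints`** — for every elliptic `E/K`, prime `p`,
  `ℤ_p`-extension `κ`, finite place `v`: if `E(K̄)[p^∞]^{D_v}` is finite then `ker r_v` is finite and
  `#ker r_v ≤ #E(K̄)[p^∞]^{D_v}` (`ker r_v ↪ B_v/(γ_v − 1)B_v`, gen 13; `ker(γ_v − 1) = E(K̄)[p^∞]^{D_v}`
  as `γ_v` and `D_v ⊓ ker κ` generate `D_v` topologically).
* **`natCard_fixedPoints_decomp_le_natCard_primaryComponent`** — Galois descent:
  `E(K̄)[p^∞]^{D_v} ↪ E(K_v)[p^∞]` (points fixed by `Γ_{K_v}` along the chosen embedding are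
  `K_v`-rational, tree `exists_map_eq_of_forall_smul_localPoints_eq`), so `#E(K̄)[p^∞]^{D_v} ≤ #E(K_v)[p^∞]`.
* The specialisation to `E/ℚ`, a degree-one `𝔭 ∣ p` and `E(ℚ_p)[p^∞]` (finite, of order `p^m`) is
  `BDPRouteLocalKernelAtPPadic.lean`.

Under the erratum's (iv) `E(ℚ_p)[p] = 0` the bound is `1` (gens 10–14: the kernel vanishes); here
NO (iv). Used by `BDPRouteControlStrictPlace` (gen 17) to count the strict place's kernel in the
control inequality (CTL≤)ᵗ. CONDITIONAL downstream use only; nothing booked; labels unchanged.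

References: [GreenbergLNM1716] §3 Lemma 3.3 and its proof (p. 87), p. 90; [Castella2018] Def. 2.2,
proof of Thm. 2.3 (arXiv:1704.06608 pp. 5–6, the factor `#H⁰(K_𝔭, E[p^∞])`);
[SilvermanAEC2009] VII.6.3, VIII.§1.
-/

noncomputable section

open scoped Classical

open NumberField IsDedekindDomain Field WeierstrassCurve
open Literature.NumberTheory.EllipticCurves Literature.NumberTheory.EllipticCurves.GreenbergSelmer
open Literature.NumberTheory.GaloisRepresentations

universe u

/-! ## §1. `#B/φ(B) ≤ #ker φ` on a `p`-primary group with finite `p^n`-torsion -/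

namespace Summit.BirchSwinnertonDyer.Rank1Residual.X11b.PrimaryCoker

variable {B : Type*} [AddCommGroup B]

/-- **`#B/φ(B) ≤ #ker φ`** for an endomorphism `φ` of an abelian group `B` in which every element is
killed by a power of `p` and every `B[p^n]` is finite, provided `ker φ` is finite (then `B/φ(B)` is
finite too). Proof: `B[p^n]` is `φ`-stable and finite, so `#B[p^n]/φ(B[p^n]) = #ker φ|_{B[p^n]} ≤ #ker φ`;
the image of `B[p^n]` in `B/φ(B)` is a quotient of `B[p^n]/φ(B[p^n])`; and every finite subset of
`B/φ(B)` lies in such an image. (Greenberg: "`B_v/(γ_v − 1)B_v` … has order bounded by the order of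
the kernel of `γ_v − 1`", the step usually done via divisibility.) [cite: GreenbergLNM1716, §3 proof of Lemma 3.3 (p. 87)] -/
theorem natCard_quotient_range_le_natCard_ker (p : ℕ) (φ : B →+ B)
    (hprim : ∀ b : B, ∃ n : ℕ, p ^ n • b = 0)
    (hfin : ∀ n : ℕ, Finite (nsmulAddMonoidHom (p ^ n) : B →+ B).ker) [Finite φ.ker] :
    Finite (B ⧸ φ.range) ∧ Nat.card (B ⧸ φ.range) ≤ Nat.card φ.ker := by
  classical
  -- every finset of the quotient has at most `#ker φ` elements
  have key : ∀ F : Finset (B ⧸ φ.range), F.card ≤ Nat.card φ.ker := by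
    intro F
    choose lift hlift using (QuotientAddGroup.mk_surjective (s := φ.range))
    choose n hn using hprim
    let N : ℕ := F.sum fun q ↦ n (lift q)
    let BN : AddSubgroup B := (nsmulAddMonoidHom (p ^ N) : B →+ B).ker
    haveI : Finite BN := hfin N
    have hmemN : ∀ q ∈ F, lift q ∈ BN := by
      intro q hq
      have hle : n (lift q) ≤ N := Finset.single_le_sum (f := fun q ↦ n (lift q))
        (fun _ _ ↦ Nat.zero_le _) hq
      change (nsmulAddMonoidHom (p ^ N) : B →+ B) (lift q) = 0
      rw [nsmulAddMonoidHom_apply, ← pow_mul_pow_sub p hle, mul_comm, mul_smul, hn (lift q),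
        smul_zero]
    -- `φ` restricted to `B[p^N]`
    have hφN : ∀ b ∈ BN, φ b ∈ BN := by
      intro b hb
      change (nsmulAddMonoidHom (p ^ N) : B →+ B) (φ b) = 0
      have hb' : (p ^ N) • b = 0 := hb
      rw [nsmulAddMonoidHom_apply, ← map_nsmul, hb', map_zero]
    let φN : BN →+ BN := (φ.comp BN.subtype).codRestrict BN fun b ↦ hφN b b.2
    -- the map `B[p^N] → B/φ(B)`
    let π : BN →+ B ⧸ φ.range := (QuotientAddGroup.mk' φ.range).comp BN.subtype
    have hF : ∀ q ∈ F, q ∈ π.range := fun q hq ↦ ⟨⟨lift q, hmemN q hq⟩, hlift q⟩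
    have hker : φN.range ≤ π.ker := by
      rintro _ ⟨b, rfl⟩
      rw [AddMonoidHom.mem_ker]
      change (((φ b : B)) : B ⧸ φ.range) = 0
      rw [QuotientAddGroup.eq_zero_iff]
      exact ⟨b, rfl⟩
    haveI : Finite π.range := Finite.of_surjective π.rangeRestrict π.rangeRestrict_surjective
    -- `#range π = [BN : ker π] ≤ [BN : range φN] = #ker φN ≤ #ker φ`
    have h1 : Nat.card π.range ≤ Nat.card (BN ⧸ φN.range) := by
      rw [← Nat.card_congr (QuotientAddGroup.quotientKerEquivRange π).toEquiv,
        ← AddSubgroup.index_eq_card, ← AddSubgroup.index_eq_card]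
      haveI : Finite (BN ⧸ φN.range) := inferInstance
      exact Nat.le_of_dvd (Nat.pos_of_ne_zero AddSubgroup.FiniteIndex.index_ne_zero)
        (AddSubgroup.index_dvd_of_le hker)
    have h2 : Nat.card (BN ⧸ φN.range) = Nat.card φN.ker :=
      TamagawaCoinvariants.natCard_quotient_range_eq_natCard_ker φN
    have h3 : Nat.card φN.ker ≤ Nat.card φ.ker := by
      refine Nat.card_le_card_of_injective (fun b ↦ ⟨((b : BN) : B), ?_⟩) ?_
      · have hb := b.2
        rw [AddMonoidHom.mem_ker] at hb ⊢
        exact congrArg (fun x : BN ↦ (x : B)) hb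
      · intro a b hab
        apply Subtype.ext; apply Subtype.ext
        exact congrArg (fun x : φ.ker ↦ (x : B)) hab
    have h4 : F.card ≤ Nat.card π.range := by
      have : Nat.card (F : Set (B ⧸ φ.range)) ≤ Nat.card π.range :=
        Nat.card_le_card_of_injective (fun q ↦ (⟨q.1, hF q.1 q.2⟩ : π.range))
          (fun a b hab ↦ Subtype.ext
            (by simpa using congrArg (fun z : π.range ↦ (z : B ⧸ φ.range)) hab))
      simpa using this
    exact h4.trans (h1.trans (h2.le.trans h3))
  -- hence the quotient is finite …
  have hfinite : Finite (B ⧸ φ.range) := by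
    by_contra hinf
    rw [not_finite_iff_infinite] at hinf
    obtain ⟨F, hF⟩ := Infinite.exists_subset_card_eq (B ⧸ φ.range) (Nat.card φ.ker + 1)
    have := key F
    omega
  refine ⟨hfinite, ?_⟩
  -- … of order `≤ #ker φ`
  haveI := Fintype.ofFinite (B ⧸ φ.range)
  rw [Nat.card_eq_fintype_card, ← Finset.card_univ]
  exact key _

end Summit.BirchSwinnertonDyer.Rank1Residual.X11b.PrimaryCoker

namespace Summit.BirchSwinnertonDyer.Rank1Residual.X11b.AcSelmer

/-! ## §2. `#ker r_v ≤ #E(K̄)[p^∞]^{D_v}` at every place (no hypothesis) -/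

section AnyPlace

variable {K : Type u} [Field K] [NumberField K] (W : WeierstrassCurve K) [W.IsElliptic]
  (p : ℕ) [Fact p.Prime] (κ : ZpExtension K p) (v : HeightOneSpectrum (𝓞 K))

omit [W.IsElliptic] in
/-- A point of `E(K̄)[p^∞]` fixed by `ker κ ⊓ D_v` and by a `γ_v ∈ D_v` generating `D_v` topologically
modulo `D_v ⊓ ker κ` is fixed by all of `D_v` (its stabiliser is open; same argument as
`decompSubOne_eq_zero_iff` for `E(K̄)`). [cite: GreenbergLNM1716, §3 Lemma 3.3 (proof, p. 87)] -/
theorem smul_eq_of_decompSubOne_eq_zero {g : ↥((⊤ : Subgroup (absoluteGaloisGroup K)) ⊓ decomp v)}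
    (hgen : ∀ U : Subgroup ↥((⊤ : Subgroup (absoluteGaloisGroup K)) ⊓ decomp v),
      IsOpen (U : Set ↥((⊤ : Subgroup (absoluteGaloisGroup K)) ⊓ decomp v)) →
        κ.kerSubgroup.subgroupOf ((⊤ : Subgroup (absoluteGaloisGroup K)) ⊓ decomp v) ≤ U →
          g ∈ U → U = ⊤)
    (m : FixedPoints.addSubgroup ↥(κ.kerSubgroup ⊓ decomp v) (W.geomPrimaryTorsion p))
    (hm : decompSubOne κ (W.geomPrimaryTorsion p) (g : absoluteGaloisGroup K)
      (Subgroup.mem_inf.mp g.2).2 m = 0) :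
    ∀ x ∈ decomp v, x • (m : W.geomPrimaryTorsion p) = m := by
  intro x hx
  have hgm : (g : absoluteGaloisGroup K) • (m : W.geomPrimaryTorsion p) = m := by
    have h1 := congrArg
      (fun z : FixedPoints.addSubgroup ↥(κ.kerSubgroup ⊓ decomp v) (W.geomPrimaryTorsion p) ↦
        (z : W.geomPrimaryTorsion p)) hm
    simp only [coe_decompSubOne_apply, ZeroMemClass.coe_zero, sub_eq_zero] at h1
    exact h1
  let U : Subgroup ↥((⊤ : Subgroup (absoluteGaloisGroup K)) ⊓ decomp v) :=
    (MulAction.stabilizer (absoluteGaloisGroup K) (m : W.geomPrimaryTorsion p)).subgroupOf _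
  have hU : IsOpen (U : Set ↥((⊤ : Subgroup (absoluteGaloisGroup K)) ⊓ decomp v)) :=
    (LocBridge.isOpen_stabilizer_geomPrimaryTorsion W p (m : W.geomPrimaryTorsion p)).preimage
      continuous_subtype_val
  have hNU : κ.kerSubgroup.subgroupOf ((⊤ : Subgroup (absoluteGaloisGroup K)) ⊓ decomp v) ≤ U := by
    intro x hx
    rw [Subgroup.mem_subgroupOf, MulAction.mem_stabilizer_iff]
    exact m.2 ⟨(x : absoluteGaloisGroup K), Subgroup.mem_inf.mpr
      ⟨Subgroup.mem_subgroupOf.mp hx, (Subgroup.mem_inf.mp x.2).2⟩⟩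
  have hgU : g ∈ U := by
    rw [Subgroup.mem_subgroupOf, MulAction.mem_stabilizer_iff]
    exact hgm
  have htop := hgen U hU hNU hgU
  have hxU : (⟨x, Subgroup.mem_inf.mpr ⟨Subgroup.mem_top x, hx⟩⟩ :
      ↥((⊤ : Subgroup (absoluteGaloisGroup K)) ⊓ decomp v)) ∈ U := by
    rw [htop]; exact Subgroup.mem_top _
  rw [Subgroup.mem_subgroupOf, MulAction.mem_stabilizer_iff] at hxU
  exact hxU

/-- **Greenberg's Lemma 3.3, kernel form, at EVERY place: `#ker r_v ≤ #E(K̄)[p^∞]^{D_v}`.** For an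
elliptic curve `E` over a number field `K`, a prime `p`, a `ℤ_p`-extension `κ` and a finite place
`v` (above `p` or not): if the `D_v`-fixed part of `E(K̄)[p^∞]` (`= E(K_v)[p^∞]` along the chosen
embedding) is finite, then `ker r_v = ker (H¹(K_v, E[p^∞]) → H¹(K_{∞,w}, E[p^∞]))` is finite and
`#ker r_v ≤ #E(K̄)[p^∞]^{D_v}` — `ker r_v ↪ B_v/(γ_v − 1)B_v` (gen 13) and `#B_v/(γ_v − 1)B_v ≤ #ker(γ_v − 1)`
(`PrimaryCoker`), `ker(γ_v − 1) ⊆ E(K̄)[p^∞]^{D_v}`. No reduction hypothesis, no hypothesis on `κ`.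
[cite: GreenbergLNM1716, §3 Lemma 3.3 and its proof (p. 87)] -/
theorem natCard_localKer_le_natCard_fixedPoints
    [hfix : Finite (FixedPoints.addSubgroup ↥(decomp v) (W.geomPrimaryTorsion p))] :
    Finite (localKer κ.kerSubgroup (W.geomPrimaryTorsion p) v) ∧
      Nat.card (localKer κ.kerSubgroup (W.geomPrimaryTorsion p) v) ≤
        Nat.card (FixedPoints.addSubgroup ↥(decomp v) (W.geomPrimaryTorsion p)) := by
  have hp : p.Prime := Fact.out
  obtain ⟨g, hgen⟩ := exists_mem_decomp_generate κ v
  have hgD : (g : absoluteGaloisGroup K) ∈ decomp v := (Subgroup.mem_inf.mp g.2).2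
  set B := FixedPoints.addSubgroup ↥(κ.kerSubgroup ⊓ decomp v) (W.geomPrimaryTorsion p)
  set φ : B →+ B := decompSubOne κ (W.geomPrimaryTorsion p) (g : absoluteGaloisGroup K) hgD with hφ
  -- `ker φ ↪ E(K̄)[p^∞]^{D_v}`
  let j : φ.ker → FixedPoints.addSubgroup ↥(decomp v) (W.geomPrimaryTorsion p) := fun b ↦
    ⟨((b : B) : W.geomPrimaryTorsion p), fun x ↦
      smul_eq_of_decompSubOne_eq_zero W p κ v hgen (b : B) ((AddMonoidHom.mem_ker).mp b.2) x x.2⟩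
  have hj : Function.Injective j := by
    intro a b hab
    apply Subtype.ext; apply Subtype.ext
    exact congrArg (fun z : FixedPoints.addSubgroup ↥(decomp v) (W.geomPrimaryTorsion p) ↦
      (z : W.geomPrimaryTorsion p)) hab
  haveI : Finite φ.ker := Finite.of_injective j hj
  have hker : Nat.card φ.ker ≤
      Nat.card (FixedPoints.addSubgroup ↥(decomp v) (W.geomPrimaryTorsion p)) :=
    Nat.card_le_card_of_injective j hj
  -- `B` is `p`-primary with finite `p^n`-torsion
  have hprim : ∀ b : B, ∃ n : ℕ, p ^ n • b = 0 := fun b ↦ by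
    obtain ⟨n, hn⟩ := (AddCommGroup.mem_primaryComponent (G := W.geomPoints)).mp
      ((b : W.geomPrimaryTorsion p)).2
    refine ⟨n, Subtype.ext (Subtype.ext ?_)⟩
    rw [AddSubgroupClass.coe_nsmul, AddSubgroupClass.coe_nsmul, hn]
    rfl
  have hfinn : ∀ n : ℕ, Finite (nsmulAddMonoidHom (p ^ n) : B →+ B).ker := fun n ↦ by
    have hS := finite_setOf_geomPrimaryTorsion_pow_smul_eq_zero W hp.ne_zero n
    haveI := hS.to_subtype
    refine Finite.of_injective (fun b : (nsmulAddMonoidHom (p ^ n) : B →+ B).ker ↦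
      (⟨((b : B) : W.geomPrimaryTorsion p), ?_⟩ :
        {m : W.geomPrimaryTorsion p | p ^ n • m = 0})) ?_
    · have hb : (p ^ n) • (b : B) = 0 := (AddMonoidHom.mem_ker).mp b.2
      exact congrArg (fun z : B ↦ (z : W.geomPrimaryTorsion p)) hb
    · intro a b hab
      apply Subtype.ext; apply Subtype.ext
      simpa using congrArg (fun z : {m : W.geomPrimaryTorsion p | p ^ n • m = 0} ↦
        ((z : W.geomPrimaryTorsion p) : W.geomPoints)) hab
  obtain ⟨hfinQ, hQ⟩ :=
    PrimaryCoker.natCard_quotient_range_le_natCard_ker p φ hprim hfinn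
  haveI := hfinQ
  obtain ⟨hfinK, hK⟩ :=
    finite_localKer_and_natCard_le κ (W.continuous_smul_geomPrimaryTorsion p) hgen
  exact ⟨hfinK, hK.trans (hQ.trans hker)⟩

/-! ## §3. Galois descent: `#E(K̄)[p^∞]^{D_v} ≤ #E(K_v)[p^∞]` -/

omit [W.IsElliptic] [Fact p.Prime] in
/-- **`E(K̄)[p^∞]^{D_v} ↪ E(K_v)[p^∞]`**: a `p`-power torsion point of `E(K̄)` fixed by the
decomposition group `D_v` maps, along the chosen embedding `K̄ → K̄_v`, to a `Γ_{K_v}`-fixed point of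
`E(K̄_v)`, which is `K_v`-rational (tree `exists_map_eq_of_forall_smul_localPoints_eq`); so if
`E(K_v)[p^∞]` is finite then so is `E(K̄)[p^∞]^{D_v}`, of order at most `#E(K_v)[p^∞]`.
[cite: SilvermanAEC2009, VIII.§1 (proof of Prop. 1.2; Galois descent of points)]
[cite: GreenbergLNM1716, §3 Lemma 3.3 (proof, p. 87: "the kernel of `γ_v − 1` … is `E(F_v)_p`")] -/
theorem natCard_fixedPoints_decomp_le_natCard_primaryComponent
    [hfin : Finite (AddCommGroup.primaryComponent
      (W.baseChange (v.adicCompletion K)).toAffine.Point p)] :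
    Finite (FixedPoints.addSubgroup ↥(decomp v) (W.geomPrimaryTorsion p)) ∧
      Nat.card (FixedPoints.addSubgroup ↥(decomp v) (W.geomPrimaryTorsion p)) ≤
        Nat.card (AddCommGroup.primaryComponent
          (W.baseChange (v.adicCompletion K)).toAffine.Point p) := by
  set ι₀ := closureEmb (K := K) (v.adicCompletion K) with hι₀
  haveI : CharZero (v.adicCompletion K) :=
    charZero_of_injective_algebraMap (algebraMap K (v.adicCompletion K)).injective
  have hinjmap := WeierstrassCurve.Affine.Point.map_injective (W' := W)
    (IsScalarTower.toAlgHom K (v.adicCompletion K) (AlgebraicClosure (v.adicCompletion K)))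
  -- every `D_v`-fixed point descends to a `K_v`-rational `p`-power torsion point
  have hdesc : ∀ m : FixedPoints.addSubgroup ↥(decomp v) (W.geomPrimaryTorsion p),
      ∃ R : AddCommGroup.primaryComponent (W.baseChange (v.adicCompletion K)).toAffine.Point p,
        Affine.Point.map
            (IsScalarTower.toAlgHom K (v.adicCompletion K) (AlgebraicClosure (v.adicCompletion K)))
            (R : (W.baseChange (v.adicCompletion K)).toAffine.Point) =
          pointsMapOfEmb W ι₀ ((m : W.geomPrimaryTorsion p) : W.geomPoints) := by
    intro m
    set X : localPoints W (v.adicCompletion K) :=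
      pointsMapOfEmb W ι₀ ((m : W.geomPrimaryTorsion p) : W.geomPoints) with hX
    have hXfix : ∀ τ : absoluteGaloisGroup (v.adicCompletion K), τ • X = X := fun τ ↦ by
      have hmem : resGalOfEmb ι₀ τ ∈ decomp v := (mem_decomp_iff v _).mpr ⟨τ, rfl⟩
      have h : resGalOfEmb ι₀ τ • ((m : W.geomPrimaryTorsion p) : W.geomPoints) =
          ((m : W.geomPrimaryTorsion p) : W.geomPoints) :=
        congrArg (fun x : W.geomPrimaryTorsion p ↦ (x : W.geomPoints)) (m.2 ⟨_, hmem⟩)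
      rw [hX, ← pointsMapOfEmb_smul, h]
    obtain ⟨R, hR⟩ := exists_map_eq_of_forall_smul_localPoints_eq W (v.adicCompletion K) hXfix
    obtain ⟨k, hk⟩ := (AddCommGroup.mem_primaryComponent (G := W.geomPoints)).mp
      ((m : W.geomPrimaryTorsion p)).2
    have hkX : p ^ k • X = 0 := by
      rw [hX, ← (pointsMapOfEmb W ι₀).map_nsmul, hk, (pointsMapOfEmb W ι₀).map_zero]
    refine ⟨⟨R, (AddCommGroup.mem_primaryComponent).mpr ⟨k, hinjmap ?_⟩⟩, hR⟩
    rw [map_nsmul, hR, map_zero]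
    exact hkX
  choose f hf using hdesc
  have hfinj : Function.Injective f := by
    intro a b hab
    have h := congrArg (fun R : AddCommGroup.primaryComponent
      (W.baseChange (v.adicCompletion K)).toAffine.Point p ↦
        Affine.Point.map
          (IsScalarTower.toAlgHom K (v.adicCompletion K) (AlgebraicClosure (v.adicCompletion K)))
          (R : (W.baseChange (v.adicCompletion K)).toAffine.Point)) hab
    simp only [hf] at h
    exact Subtype.ext (Subtype.ext (pointsMapOfEmb_injective W ι₀ h))
  exact ⟨Finite.of_injective f hfinj, Nat.card_le_card_of_injective f hfinj⟩

/-- **`#ker r_v ≤ #E(K_v)[p^∞]`** (Greenberg's Lemma 3.3, kernel form, every place; the order of the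
`p`-power torsion of the `K_v`-points of `W`, assumed finite). [cite: GreenbergLNM1716, §3 Lemma 3.3 and its proof (p. 87)] -/
theorem natCard_localKer_le_natCard_primaryComponent
    [Finite (AddCommGroup.primaryComponent (W.baseChange (v.adicCompletion K)).toAffine.Point p)] :
    Finite (localKer κ.kerSubgroup (W.geomPrimaryTorsion p) v) ∧
      Nat.card (localKer κ.kerSubgroup (W.geomPrimaryTorsion p) v) ≤
        Nat.card (AddCommGroup.primaryComponent
          (W.baseChange (v.adicCompletion K)).toAffine.Point p) := by
  obtain ⟨hfinF, hF⟩ := natCard_fixedPoints_decomp_le_natCard_primaryComponent W p v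
  haveI := hfinF
  obtain ⟨hfinK, hK⟩ := natCard_localKer_le_natCard_fixedPoints W p κ v
  exact ⟨hfinK, hK.trans hF⟩

end AnyPlace

end Summit.BirchSwinnertonDyer.Rank1Residual.X11b.AcSelmer

end
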